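import Mathlib
import HarnessLib
import Summits.Ventures.LatticeQCDFlow.Exactness.Phi4FlowSamplerErgodic
import Summits.Ventures.LatticeQCDFlow.Scaling.IdentityFlowAcceptanceCouplingStrict
import Summits.Ventures.LatticeQCDFlow.Scaling.IdentityFlowAcceptanceStrongCoupling
import Summits.Ventures.LatticeQCDFlow.Scaling.IdentityFlowHoldingTimeCouplingMonotone

/-!
# LatticeQCDFlow / Scaling — any reference law tilted by `e^{−λV}` (`V` with `∫e^{−γV} < ∞`,
# `γ ≥ 0` — every interaction bounded below): acceptance antitone (strictly) and holding time
# monotone in `λ ≥ 0`; the lattice φ⁴ COUPLING TRANSFER of a perfectly trained flow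

HONEST FRAMING: exact (Metropolis-corrected) sampling algorithms for lattice gauge theory;
figures of merit are autocorrelation/cost numbers at stated couplings and volumes; no
continuum-physics claim.

Venture `LatticeQCDFlow` (cell pub-lqcd), topic `Scaling`; FANOUT row 3 (`s0-u1-a`, S0-B
implementation A, GEN-17).  COROLLARIES (no new estimate) of row 3's GEN-17 laws
`Scaling/TiltAcceptanceCouplingMonotone`, `…CouplingStrict`, `…StrongCoupling`,
`Scaling/IdentityFlowHoldingTimeCouplingMonotone` (imported) — whose exponential-moment hypothesis is ONE-SIDED (`γ ≥ 0`) precisely so that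
statistics bounded above qualify — for the tilt `e^{−λV}μ/Z(λ)` of an arbitrary probability law `μ`
by an interaction `V` with `∫ e^{−γV} dμ < ∞` for `γ ≥ 0` (every `V ≥ 0`, every `V` bounded below), and
their instance for row 2's lattice φ⁴ theory (`Exactness/Phi4FlowSamplerErgodic.phi4GibbsMeasure`,
`Scoring….gibbsWeight`, `latticePhi4Action J λ φ = φ·Jφ + λΣφ_x⁴`, imported): the Gibbs law at
quartic coupling `λ` is the tilt of the Gibbs law at `λ₀` by `e^{−(λ−λ₀)Σφ_x⁴}`, so a flow trained
PERFECTLY at `λ₀` and re-used as the exact sampler's proposal at `λ ≥ λ₀` is an untrained sampler of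
this file's kind with `V = Σ_x φ_x⁴ ≥ 0`.  NO definition is introduced.

* §1 any `μ`, `V`: `actionTilt_partition_pos`; **`actionTilt_meanAccept_antitoneOn`** (the acceptance
  `∫∫ min(p_λ(x), p_λ(y)) dμ dμ`, `p_λ = e^{−λV}/Z(λ)`, is NON-INCREASING on `[0, ∞)`);
  **`actionTilt_meanAccept_strictAntiOn`** (STRICT given a level `c` with `μ{c < V} > 0`,
  `μ{V ≤ c} > 0`); **`actionTilt_holdingTime_monotoneOn`** (the mean holding time `E_π[1/a]` in row 2's
  `rejCurve` vocabulary is NON-DECREASING on `[0, ∞)`).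
* §2 φ⁴, every `n`, every coupling matrix `J`, every `λ₀ > 0`: `phi4GibbsMeasure_pos_of_volume_pos`
  (positive density, `Z < ∞`), `phi4_quartic_level` (the level `1` of `Σφ⁴` is two-sided);
  **`phi4Transfer_meanAccept_antitoneOn`** (the transferred acceptance is NON-INCREASING in `λ` on
  `[λ₀, ∞)`), **`phi4Transfer_meanAccept_strictAntiOn`** (STRICTLY), **`phi4Transfer_holdingTime_monotoneOn`**
  (holding time NON-DECREASING on `[λ₀, ∞)`); `phi4Gibbs_integrable_exp_mul_quartic` (the Gibbs law
  at `λ₀` has the LOCAL moments `∫e^{−γΣφ⁴}dμ_{λ₀} < ∞`, `|γ| < λ₀`),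
  **`phi4Transfer_one_sub_meanAccept_div_tendsto`** — `(1 − acc(λ₀→λ))/(λ − λ₀) → ½·E_{λ₀}|Σφ⁴ − Σφ′⁴|`
  as `λ ↓ λ₀` (`Scaling/IdentityFlowAcceptanceStrongCoupling`, whose hypothesis is local for this).

Reading (value-free; no number of ours is computed or implied): the coupling-transfer law of
`Scaling/WilsonCouplingTransferMonotone` is not special to gauge theories — for row 2's φ⁴ flow
sampler a model that is exact at `λ₀` loses acceptance monotonically (strictly) and gains holding time
as the target's quartic coupling is raised above `λ₀`.  NOT CLAIMED: the monotone law on the side `λ < λ₀` (the Gibbs law at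
`λ₀` has the moments `e^{+γΣφ⁴}` only for `γ < λ₀`, outside the one-sided hypothesis as stated);
imperfectly trained flows; any value at the cell's couplings; nothing re-scored, SEALED.md untouched.
-/

noncomputable section

namespace Summit.Ventures.LatticeQCDFlow.Theory2

open MeasureTheory Real Set Filter Topology
open Summit.Ventures.LatticeQCDFlow.Exactness (rejCurve phi4GibbsMeasure isProbabilityMeasure_phi4GibbsMeasure)
open Summit.Ventures.LatticeQCDFlow.Scoring (gibbsWeight gibbsZ gibbsWeight_pos gibbsZ_pos continuous_gibbsWeight
  latticePhi4Action integrable_gibbsWeight)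

/-! ## §1 A reference probability law tilted by `e^{−λV}`, `V` with `∫e^{−γV} dμ < ∞` for `γ ≥ 0` -/

section Action

variable {Ω : Type*} [MeasurableSpace Ω] (μ : Measure Ω) [IsProbabilityMeasure μ] {V : Ω → ℝ}
  (hVm : Measurable V) (hint : ∀ γ : ℝ, 0 ≤ γ → Integrable (fun x => Real.exp (-γ * V x)) μ)
include hVm hint

omit hVm in
/-- `Z(λ) = ∫ e^{−λV} dμ > 0` for `λ ≥ 0`. [folklore] -/
theorem actionTilt_partition_pos {lam : ℝ} (hlam : 0 ≤ lam) : 0 < ∫ x, Real.exp (-lam * V x) ∂μ := by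
  rw [integral_pos_iff_support_of_nonneg (fun x => (Real.exp_pos _).le) (hint lam hlam),
    show Function.support (fun x => Real.exp (-lam * V x)) = univ from
      eq_univ_of_forall fun x => (Real.exp_pos _).ne']
  rw [measure_univ]; exact one_pos

/-- **ACTION TILTS OF ANY REFERENCE LAW: the acceptance is NON-INCREASING in `λ ≥ 0`.**  For a
probability law `μ` and a measurable `V` with `∫ e^{−γV} dμ < ∞` for `γ ≥ 0` (every `V` bounded below —
a polynomial interaction, a Wilson action), the equilibrium acceptance
`∫∫ min(p_λ(x), p_λ(y)) dμ dμ`, `p_λ = e^{−λV}/∫e^{−λV}dμ`, of `μ`-proposals against `e^{−λV}μ/Z(λ)` is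
non-increasing on `[0, ∞)` (`Scaling/TiltAcceptanceCouplingMonotone` with `q ≡ 1`, `T = −V`). [ours] -/
theorem actionTilt_meanAccept_antitoneOn :
    AntitoneOn (fun lam : ℝ => ∫ x, ∫ y,
        min (Real.exp (-lam * V x) / ∫ z, Real.exp (-lam * V z) ∂μ)
          (Real.exp (-lam * V y) / ∫ z, Real.exp (-lam * V z) ∂μ) ∂μ ∂μ) (Ici 0) := by
  have hint' : ∀ γ : ℝ, 0 ≤ γ → Integrable (fun x => (1 : ℝ) * Real.exp (γ * -V x)) μ :=
    fun γ hγ => by simpa only [one_mul, mul_neg, neg_mul] using hint γ hγ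
  have hMpos : ∀ γ : ℝ, 0 ≤ γ → 0 < ∫ x, (1 : ℝ) * Real.exp (γ * -V x) ∂μ := fun γ hγ => by
    simpa only [one_mul, mul_neg, neg_mul] using actionTilt_partition_pos μ hint hγ
  have h := tiltIMH_meanAccept_antitoneOn (ν := μ) (q := fun _ => (1 : ℝ)) (T := fun x => -V x)
    (fun _ => zero_le_one) measurable_const hVm.neg hint' hMpos
  intro lam hlam lam' hlam' hle
  have e : ∀ γ : ℝ, (∫ x, ∫ y, min (Real.exp (-γ * V x) / ∫ z, Real.exp (-γ * V z) ∂μ)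
      (Real.exp (-γ * V y) / ∫ z, Real.exp (-γ * V z) ∂μ) ∂μ ∂μ)
      = (∫ x, ∫ y, (1 : ℝ) * 1 * min (Real.exp (γ * -V x)) (Real.exp (γ * -V y)) ∂μ ∂μ)
        / ∫ z, 1 * Real.exp (γ * -V z) ∂μ := fun γ => by
    have hZ : 0 ≤ ∫ z, Real.exp (-γ * V z) ∂μ := integral_nonneg fun z => (Real.exp_pos _).le
    simp_rw [one_mul, mul_neg, ← neg_mul, min_div_div_right hZ, integral_div]
  simp only [e]
  exact h hlam hlam' hle

omit [IsProbabilityMeasure μ] in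
/-- **… STRICTLY**, as soon as some level `c` has `μ{V ≤ c} > 0` and `μ{c < V} > 0` (i.e. `V` is not
`μ`-a.e. constant in the two-sided sense). [ours] -/
theorem actionTilt_meanAccept_strictAntiOn (hV : ∃ c : ℝ, 0 < μ {x | c < V x} ∧ 0 < μ {x | V x ≤ c}) :
    StrictAntiOn (fun lam : ℝ => ∫ x, ∫ y,
        min (Real.exp (-lam * V x) / ∫ z, Real.exp (-lam * V z) ∂μ)
          (Real.exp (-lam * V y) / ∫ z, Real.exp (-lam * V z) ∂μ) ∂μ ∂μ) (Ici 0) := by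
  have hint' : ∀ γ : ℝ, 0 ≤ γ → Integrable (fun x => (1 : ℝ) * Real.exp (γ * -V x)) μ :=
    fun γ hγ => by simpa only [one_mul, mul_neg, neg_mul] using hint γ hγ
  obtain ⟨c, hc1, hc2⟩ := hV
  have hT : ∃ c' : ℝ, 0 < μ {x | -V x < c'} ∧ 0 < μ {x | c' ≤ -V x} := by
    refine ⟨-c, ?_, ?_⟩
    · have ee : {x | -V x < -c} = {x | c < V x} := by ext x; simp only [mem_setOf_eq, neg_lt_neg_iff]
      rwa [ee]
    · have ee : {x | -c ≤ -V x} = {x | V x ≤ c} := by ext x; simp only [mem_setOf_eq, neg_le_neg_iff]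
      rwa [ee]
  have h := tiltIMH_meanAccept_strictAntiOn_of_pos (ν := μ) (q := fun _ => (1 : ℝ))
    (T := fun x => -V x) measurable_const hVm.neg hint' (fun _ => one_pos) hT
  intro lam hlam lam' hlam' hlt
  have e : ∀ γ : ℝ, (∫ x, ∫ y, min (Real.exp (-γ * V x) / ∫ z, Real.exp (-γ * V z) ∂μ)
      (Real.exp (-γ * V y) / ∫ z, Real.exp (-γ * V z) ∂μ) ∂μ ∂μ)
      = (∫ x, ∫ y, (1 : ℝ) * 1 * min (Real.exp (γ * -V x)) (Real.exp (γ * -V y)) ∂μ ∂μ)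
        / ∫ z, 1 * Real.exp (γ * -V z) ∂μ := fun γ => by
    have hZ : 0 ≤ ∫ z, Real.exp (-γ * V z) ∂μ := integral_nonneg fun z => (Real.exp_pos _).le
    simp_rw [one_mul, mul_neg, ← neg_mul, min_div_div_right hZ, integral_div]
  simp only [e]
  exact h hlam hlam' hlt

/-- **… and the MEAN HOLDING TIME `E_π[1/a]` is NON-DECREASING in `λ ≥ 0`** (row 2's rejection-curve
vocabulary, `Scaling/IdentityFlowHoldingTimeCouplingMonotone` with `c = 1`). [ours] -/
theorem actionTilt_holdingTime_monotoneOn :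
    MonotoneOn (fun lam : ℝ => (∫ x, Real.exp (-lam * V x)
        / (1 - rejCurve μ (fun z => Real.exp (-lam * V z)) (fun _ => (1 : ℝ))
            (Real.exp (-lam * V x) / 1)) ∂μ)
        / ∫ z, Real.exp (-lam * V z) ∂μ) (Ici 0) := by
  have hc1 : ∫ _x : Ω, (1 : ℝ) ∂μ = 1 := by rw [integral_const, probReal_univ, one_smul]
  have hint' : ∀ γ : ℝ, 0 ≤ γ → Integrable (fun x => Real.exp (γ * -V x)) μ :=
    fun γ hγ => by simpa only [mul_neg, neg_mul] using hint γ hγ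
  have h := tiltIMH_holdingTime_monotoneOn (ν := μ) (c := (1 : ℝ)) (T := fun x => -V x)
    one_pos hc1 hVm.neg hint'
  intro lam hlam lam' hlam' hle
  have e : ∀ γ : ℝ, (fun z : Ω => Real.exp (-γ * V z)) = fun z => Real.exp (γ * -V z) :=
    fun γ => by funext z; rw [mul_neg, neg_mul]
  have h' := h hlam hlam' hle
  simp only [e, mul_neg, ← neg_mul] at h' ⊢
  exact h'

end Action

/-! ## §2 The lattice φ⁴ theory: COUPLING TRANSFER of a perfectly trained flow -/

section Phi4

variable {n : ℕ}

/-- The φ⁴ Gibbs law at `λ₀ > 0` charges every set of positive Lebesgue measure (positive density,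
finite partition function). [folklore] -/
theorem phi4GibbsMeasure_pos_of_volume_pos {lam₀ : ℝ} (hlam₀ : 0 < lam₀)
    (J : Fin (n + 1) → Fin (n + 1) → ℝ) {A : Set (Fin (n + 1) → ℝ)} (hA : 0 < volume A) :
    0 < phi4GibbsMeasure J lam₀ A := by
  rw [pos_iff_ne_zero] at hA ⊢
  unfold phi4GibbsMeasure
  have hfm : Measurable fun φ : Fin (n + 1) → ℝ =>
      ENNReal.ofReal (gibbsWeight J lam₀ φ / gibbsZ J lam₀) :=
    ENNReal.measurable_ofReal.comp ((continuous_gibbsWeight J lam₀).measurable.div_const _)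
  rw [Ne, withDensity_apply_eq_zero hfm]
  rwa [show {φ : Fin (n + 1) → ℝ | ENNReal.ofReal (gibbsWeight J lam₀ φ / gibbsZ J lam₀) ≠ 0} ∩ A = A
    from by
      rw [inter_eq_right]
      exact fun φ _ => (ENNReal.ofReal_pos.2
        (div_pos (gibbsWeight_pos J lam₀ φ) (gibbsZ_pos hlam₀ J))).ne']

/-- The quartic interaction `V(φ) = Σ_x φ_x⁴` takes values below and above the level `1` on sets of
positive Lebesgue (hence Gibbs) measure. [ours] -/
theorem phi4_quartic_level {lam₀ : ℝ} (hlam₀ : 0 < lam₀) (J : Fin (n + 1) → Fin (n + 1) → ℝ) :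
    0 < phi4GibbsMeasure J lam₀ {φ : Fin (n + 1) → ℝ | (1 : ℝ) < ∑ x, φ x ^ 4} ∧
      0 < phi4GibbsMeasure J lam₀ {φ : Fin (n + 1) → ℝ | ∑ x, φ x ^ 4 ≤ 1} := by
  have hcont : Continuous fun φ : Fin (n + 1) → ℝ => ∑ x, φ x ^ 4 :=
    continuous_finsetSum _ fun x _ => (continuous_apply x).pow 4
  constructor
  · refine phi4GibbsMeasure_pos_of_volume_pos hlam₀ J ((isOpen_lt continuous_const hcont).measure_pos
      volume ⟨fun _ => 2, ?_⟩)
    rw [mem_setOf_eq]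
    calc (1 : ℝ) < 2 ^ 4 := by norm_num
      _ ≤ ∑ x : Fin (n + 1), (2 : ℝ) ^ 4 := by
          rw [Finset.sum_const, Finset.card_univ, Fintype.card_fin, nsmul_eq_mul]
          have : (1 : ℝ) ≤ (n + 1 : ℕ) := by exact_mod_cast Nat.succ_le_succ (Nat.zero_le n)
          nlinarith
  · refine phi4GibbsMeasure_pos_of_volume_pos hlam₀ J (lt_of_lt_of_le
      ((isOpen_lt hcont continuous_const).measure_pos volume ⟨fun _ => 0, ?_⟩)
      (measure_mono fun φ (hφ : ∑ x, φ x ^ 4 < 1) => le_of_lt hφ))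
    rw [mem_setOf_eq]
    simp

/-- **φ⁴ COUPLING TRANSFER, MONOTONE**: a flow trained PERFECTLY at quartic coupling `λ₀ > 0` (its
model law IS the Gibbs law `phi4GibbsMeasure J λ₀`), used as the proposal of the exact sampler for
the Gibbs law at `λ ≥ λ₀` (target density `e^{−(λ−λ₀)Σφ⁴}/∫e^{−(λ−λ₀)Σφ⁴}dμ_{λ₀}` w.r.t. the proposal):
its equilibrium acceptance is NON-INCREASING in `λ` on `[λ₀, ∞)` — every `n`, every coupling matrix
`J`. [ours] -/
theorem phi4Transfer_meanAccept_antitoneOn {lam₀ : ℝ} (hlam₀ : 0 < lam₀)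
    (J : Fin (n + 1) → Fin (n + 1) → ℝ) :
    AntitoneOn (fun lam : ℝ => ∫ φ, ∫ φ',
        min (Real.exp (-(lam - lam₀) * ∑ x, φ x ^ 4)
            / ∫ ψ, Real.exp (-(lam - lam₀) * ∑ x, ψ x ^ 4) ∂(phi4GibbsMeasure J lam₀))
          (Real.exp (-(lam - lam₀) * ∑ x, φ' x ^ 4)
            / ∫ ψ, Real.exp (-(lam - lam₀) * ∑ x, ψ x ^ 4) ∂(phi4GibbsMeasure J lam₀))
        ∂(phi4GibbsMeasure J lam₀) ∂(phi4GibbsMeasure J lam₀)) (Ici lam₀) := by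
  haveI := isProbabilityMeasure_phi4GibbsMeasure hlam₀ J
  have hVm : Measurable fun φ : Fin (n + 1) → ℝ => ∑ x, φ x ^ 4 :=
    Finset.measurable_sum _ fun x _ => (measurable_pi_apply x).pow_const 4
  have hint : ∀ γ : ℝ, 0 ≤ γ → Integrable (fun φ : Fin (n + 1) → ℝ => Real.exp (-γ * ∑ x, φ x ^ 4))
      (phi4GibbsMeasure J lam₀) := fun γ hγ => by
    refine Integrable.of_bound (C := 1)
      (Real.measurable_exp.comp (hVm.const_mul _)).aestronglyMeasurable (ae_of_all _ fun φ => ?_)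
    rw [Real.norm_eq_abs, abs_of_nonneg (Real.exp_pos _).le, Real.exp_le_one_iff]
    exact mul_nonpos_of_nonpos_of_nonneg (neg_nonpos.2 hγ)
      (Finset.sum_nonneg fun x _ => by positivity)
  have h := actionTilt_meanAccept_antitoneOn (phi4GibbsMeasure J lam₀) hVm hint
  intro lam hlam lam' hlam' hle
  exact h (mem_Ici.2 (sub_nonneg.2 (mem_Ici.1 hlam))) (mem_Ici.2 (sub_nonneg.2 (mem_Ici.1 hlam')))
    (sub_le_sub_right hle lam₀)

/-- **φ⁴ COUPLING TRANSFER, STRICT**: the transferred acceptance is STRICTLY decreasing on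
`[λ₀, ∞)`. [ours] -/
theorem phi4Transfer_meanAccept_strictAntiOn {lam₀ : ℝ} (hlam₀ : 0 < lam₀)
    (J : Fin (n + 1) → Fin (n + 1) → ℝ) :
    StrictAntiOn (fun lam : ℝ => ∫ φ, ∫ φ',
        min (Real.exp (-(lam - lam₀) * ∑ x, φ x ^ 4)
            / ∫ ψ, Real.exp (-(lam - lam₀) * ∑ x, ψ x ^ 4) ∂(phi4GibbsMeasure J lam₀))
          (Real.exp (-(lam - lam₀) * ∑ x, φ' x ^ 4)
            / ∫ ψ, Real.exp (-(lam - lam₀) * ∑ x, ψ x ^ 4) ∂(phi4GibbsMeasure J lam₀))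
        ∂(phi4GibbsMeasure J lam₀) ∂(phi4GibbsMeasure J lam₀)) (Ici lam₀) := by
  haveI := isProbabilityMeasure_phi4GibbsMeasure hlam₀ J
  have hVm : Measurable fun φ : Fin (n + 1) → ℝ => ∑ x, φ x ^ 4 :=
    Finset.measurable_sum _ fun x _ => (measurable_pi_apply x).pow_const 4
  have hint : ∀ γ : ℝ, 0 ≤ γ → Integrable (fun φ : Fin (n + 1) → ℝ => Real.exp (-γ * ∑ x, φ x ^ 4))
      (phi4GibbsMeasure J lam₀) := fun γ hγ => by
    refine Integrable.of_bound (C := 1)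
      (Real.measurable_exp.comp (hVm.const_mul _)).aestronglyMeasurable (ae_of_all _ fun φ => ?_)
    rw [Real.norm_eq_abs, abs_of_nonneg (Real.exp_pos _).le, Real.exp_le_one_iff]
    exact mul_nonpos_of_nonpos_of_nonneg (neg_nonpos.2 hγ)
      (Finset.sum_nonneg fun x _ => by positivity)
  have h := actionTilt_meanAccept_strictAntiOn (phi4GibbsMeasure J lam₀) hVm hint
    ⟨1, phi4_quartic_level hlam₀ J⟩
  intro lam hlam lam' hlam' hlt
  exact h (mem_Ici.2 (sub_nonneg.2 (mem_Ici.1 hlam))) (mem_Ici.2 (sub_nonneg.2 (mem_Ici.1 hlam')))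
    (sub_lt_sub_right hlt lam₀)

/-- **φ⁴ COUPLING TRANSFER, HOLDING TIME**: the equilibrium mean holding time `E_π[1/a]` of the
transferred sampler (row 2's `rejCurve` vocabulary, as in `Scaling/IMHHoldingTimeESS.phi4Flow_…`) is
NON-DECREASING in `λ` on `[λ₀, ∞)`. [ours] -/
theorem phi4Transfer_holdingTime_monotoneOn {lam₀ : ℝ} (hlam₀ : 0 < lam₀)
    (J : Fin (n + 1) → Fin (n + 1) → ℝ) :
    MonotoneOn (fun lam : ℝ => (∫ φ, Real.exp (-(lam - lam₀) * ∑ x, φ x ^ 4)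
        / (1 - rejCurve (phi4GibbsMeasure J lam₀) (fun ψ => Real.exp (-(lam - lam₀) * ∑ x, ψ x ^ 4))
            (fun _ => (1 : ℝ)) (Real.exp (-(lam - lam₀) * ∑ x, φ x ^ 4) / 1)) ∂(phi4GibbsMeasure J lam₀))
        / ∫ ψ, Real.exp (-(lam - lam₀) * ∑ x, ψ x ^ 4) ∂(phi4GibbsMeasure J lam₀)) (Ici lam₀) := by
  haveI := isProbabilityMeasure_phi4GibbsMeasure hlam₀ J
  have hVm : Measurable fun φ : Fin (n + 1) → ℝ => ∑ x, φ x ^ 4 :=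
    Finset.measurable_sum _ fun x _ => (measurable_pi_apply x).pow_const 4
  have hint : ∀ γ : ℝ, 0 ≤ γ → Integrable (fun φ : Fin (n + 1) → ℝ => Real.exp (-γ * ∑ x, φ x ^ 4))
      (phi4GibbsMeasure J lam₀) := fun γ hγ => by
    refine Integrable.of_bound (C := 1)
      (Real.measurable_exp.comp (hVm.const_mul _)).aestronglyMeasurable (ae_of_all _ fun φ => ?_)
    rw [Real.norm_eq_abs, abs_of_nonneg (Real.exp_pos _).le, Real.exp_le_one_iff]
    exact mul_nonpos_of_nonpos_of_nonneg (neg_nonpos.2 hγ)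
      (Finset.sum_nonneg fun x _ => by positivity)
  have h := actionTilt_holdingTime_monotoneOn (phi4GibbsMeasure J lam₀) hVm hint
  intro lam hlam lam' hlam' hle
  exact h (mem_Ici.2 (sub_nonneg.2 (mem_Ici.1 hlam))) (mem_Ici.2 (sub_nonneg.2 (mem_Ici.1 hlam')))
    (sub_le_sub_right hle lam₀)

/-- Under the Gibbs law at `λ₀ > 0` the quartic interaction has the exponential moments
`∫ e^{−γΣφ⁴} dμ_{λ₀} < ∞` for `|γ| < λ₀` (the integrand is the Gibbs weight at `λ₀ + γ > 0` over
`Z(λ₀)`). [ours] -/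
theorem phi4Gibbs_integrable_exp_mul_quartic {lam₀ : ℝ} (hlam₀ : 0 < lam₀)
    (J : Fin (n + 1) → Fin (n + 1) → ℝ) {γ : ℝ} (hγ : |γ| < lam₀) :
    Integrable (fun φ : Fin (n + 1) → ℝ => Real.exp (γ * -∑ x, φ x ^ 4)) (phi4GibbsMeasure J lam₀) := by
  have hfm : Measurable fun φ : Fin (n + 1) → ℝ =>
      ENNReal.ofReal (gibbsWeight J lam₀ φ / gibbsZ J lam₀) :=
    ENNReal.measurable_ofReal.comp ((continuous_gibbsWeight J lam₀).measurable.div_const _)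
  unfold phi4GibbsMeasure
  rw [integrable_withDensity_iff_integrable_smul' hfm (ae_of_all _ fun _ => ENNReal.ofReal_lt_top)]
  have e : (fun φ : Fin (n + 1) → ℝ => (ENNReal.ofReal (gibbsWeight J lam₀ φ / gibbsZ J lam₀)).toReal
      • Real.exp (γ * -∑ x, φ x ^ 4)) = fun φ => gibbsWeight J (lam₀ + γ) φ / gibbsZ J lam₀ := by
    funext φ
    rw [ENNReal.toReal_ofReal (div_nonneg (gibbsWeight_pos J lam₀ φ).le (gibbsZ_pos hlam₀ J).le),
      smul_eq_mul, div_mul_eq_mul_div]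
    congr 1
    simp only [gibbsWeight, latticePhi4Action]
    rw [← Real.exp_add]
    congr 1; ring
  rw [e]
  exact (integrable_gibbsWeight (by linarith [(abs_lt.1 hγ).1]) J).div_const _

/-- **φ⁴ COUPLING TRANSFER, FIRST ORDER**: as the target quartic coupling `λ ↓ λ₀`,
`(1 − acc(λ₀ → λ))/(λ − λ₀) → ½·∫∫ |Σφ_x⁴ − Σφ′_x⁴| dμ_{λ₀} dμ_{λ₀}` — the transferred acceptance
leaves `1` LINEARLY with slope half the Gini mean difference of the quartic interaction under the
training law (`Scaling/IdentityFlowAcceptanceStrongCoupling` with the LOCAL moments `|γ| < λ₀`).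
[ours] -/
theorem phi4Transfer_one_sub_meanAccept_div_tendsto {lam₀ : ℝ} (hlam₀ : 0 < lam₀)
    (J : Fin (n + 1) → Fin (n + 1) → ℝ) :
    Tendsto (fun lam : ℝ => (1 - ∫ φ, ∫ φ',
        min (Real.exp (-(lam - lam₀) * ∑ x, φ x ^ 4)
            / ∫ ψ, Real.exp (-(lam - lam₀) * ∑ x, ψ x ^ 4) ∂(phi4GibbsMeasure J lam₀))
          (Real.exp (-(lam - lam₀) * ∑ x, φ' x ^ 4)
            / ∫ ψ, Real.exp (-(lam - lam₀) * ∑ x, ψ x ^ 4) ∂(phi4GibbsMeasure J lam₀))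
        ∂(phi4GibbsMeasure J lam₀) ∂(phi4GibbsMeasure J lam₀)) / (lam - lam₀))
      (𝓝[>] lam₀) (𝓝 (1 / 2 * ∫ φ, ∫ φ', |∑ x, φ x ^ 4 - ∑ x, φ' x ^ 4|
        ∂(phi4GibbsMeasure J lam₀) ∂(phi4GibbsMeasure J lam₀))) := by
  haveI := isProbabilityMeasure_phi4GibbsMeasure hlam₀ J
  have hVm : Measurable fun φ : Fin (n + 1) → ℝ => ∑ x, φ x ^ 4 :=
    Finset.measurable_sum _ fun x _ => (measurable_pi_apply x).pow_const 4
  have h := tiltIMH_one_sub_meanAccept_div_tendsto (μ := phi4GibbsMeasure J lam₀)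
    (T := fun φ : Fin (n + 1) → ℝ => -∑ x, φ x ^ 4) hVm.neg hlam₀
    (fun γ hγ => phi4Gibbs_integrable_exp_mul_quartic hlam₀ J hγ)
  simp only [neg_sub_neg] at h
  have e : ∫ φ, ∫ φ', |∑ x, φ' x ^ 4 - ∑ x, φ x ^ 4| ∂(phi4GibbsMeasure J lam₀) ∂(phi4GibbsMeasure J lam₀)
      = ∫ φ, ∫ φ', |∑ x, φ x ^ 4 - ∑ x, φ' x ^ 4| ∂(phi4GibbsMeasure J lam₀) ∂(phi4GibbsMeasure J lam₀) :=
    integral_congr_ae (ae_of_all _ fun φ => integral_congr_ae (ae_of_all _ fun φ' => abs_sub_comm _ _))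
  rw [e] at h
  -- ratio form ↔ divided form, and the change of variable `δ = λ − λ₀`
  have eacc : ∀ δ : ℝ, (∫ φ, ∫ φ', min (Real.exp (-δ * ∑ x, φ x ^ 4)
        / ∫ ψ, Real.exp (-δ * ∑ x, ψ x ^ 4) ∂(phi4GibbsMeasure J lam₀))
      (Real.exp (-δ * ∑ x, φ' x ^ 4) / ∫ ψ, Real.exp (-δ * ∑ x, ψ x ^ 4) ∂(phi4GibbsMeasure J lam₀))
      ∂(phi4GibbsMeasure J lam₀) ∂(phi4GibbsMeasure J lam₀))
      = (∫ φ, ∫ φ', min (Real.exp (δ * -∑ x, φ x ^ 4)) (Real.exp (δ * -∑ x, φ' x ^ 4))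
          ∂(phi4GibbsMeasure J lam₀) ∂(phi4GibbsMeasure J lam₀))
        / ∫ ψ, Real.exp (δ * -∑ x, ψ x ^ 4) ∂(phi4GibbsMeasure J lam₀) := fun δ => by
    have hZ : 0 ≤ ∫ ψ, Real.exp (-δ * ∑ x, ψ x ^ 4) ∂(phi4GibbsMeasure J lam₀) :=
      integral_nonneg fun ψ => (Real.exp_pos _).le
    simp_rw [mul_neg, ← neg_mul, min_div_div_right hZ, integral_div]
  have hsub : Tendsto (fun lam : ℝ => lam - lam₀) (𝓝[>] lam₀) (𝓝[>] 0) := by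
    refine tendsto_nhdsWithin_of_tendsto_nhds_of_eventually_within _ ?_
      (eventually_nhdsWithin_of_forall fun lam hlam => mem_Ioi.2 (sub_pos.2 hlam))
    have hc : Tendsto (fun lam : ℝ => lam - lam₀) (𝓝 lam₀) (𝓝 (lam₀ - lam₀)) :=
      (continuous_sub_right lam₀).tendsto lam₀
    rw [sub_self] at hc
    exact hc.mono_left nhdsWithin_le_nhds
  simp only [eacc]
  exact h.comp hsub

end Phi4

end Summit.Ventures.LatticeQCDFlow.Theory2
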